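import Summits.CriticalPhenomena.PercolationContinuityZ3.Theorems.PercNearOneGluingNoHeavyPcintChainBondIneq
import HarnessLib

/-!
# PCINT lane, reduction B3t (`chordthird_cw`: B3c with a sharper unit for third and later incidences): the per-site inequality

Cell `prim-pcint` (PAPER-2 track (iii): certified intervals for `p_c(ℤ^d)`), seat `prim-pcint-2` (gen 4); support file
(`--supports stmt-CriticalPhenomena-4575`).  Does NOT build on p205010.  Memo: `run/shared/lean/prim/pcint/REDUCTIONS.md` §B3t.

As in `…ChainBondIneq`, at an off-path site with `r` incidence edges and `g` good consecutive pairs,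
`P(F_w) ≤ siteProb r g p = (1-p)^r + r p (1-p)^{r-1} + g p² (1-p)^{r-2}`.  B3t pays TWO kinds of units: `s` (second
incidences, bonus units, corner coins) and a sharper `t` for every linked incidence that is at least the THIRD of its site and
at gap `≥ 4` from its predecessor; with `a` units `s` and `b` units `t` the bookkeeping guarantees (`…ThirdBondUnits`)
`a + b ≤ r`, `g + b ≤ r - 2` when the first pair is not a good corner pair, and `a + b ≤ r - 2`, `g + b ≤ r - 1`, `g ≥ 1`
when it is.  PROVED here, for reals with `0 ≤ p ≤ 1`, `1 - p² ≤ s²`, `0 ≤ t ≤ s ≤ 1`, `(1-p)(1+2p) ≤ t (1+p)` and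
`p² (1-p) ≤ s² (s - t)`:  `siteProb r g p ≤ s^a t^b` in both cases (`siteProb_le_pow2_of_first_bad`,
`siteProb_le_pow2_of_first_good`).  Cores: `P₀(m+2) ≤ s² t^m` (ratio `P₀(r+1)/P₀(r) ≤ (1-p)(1+2p)/(1+p)` for `r ≥ 2`) and
`P₀(m+2) + p²(1-p)^m ≤ t^m`; each further good pair trades one `t` for one `s`.  With `t = (1-p)(1+2p)/(1+p)` the case
`r = 3`, `g = 0` is an equality.
-/

noncomputable section

namespace Summit.CriticalPhenomena.PercolationContinuityZ3.Theorems.Pcint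

namespace ChainBond

section Ineq2

variable {p s t : ℝ} (hp0 : 0 ≤ p) (hp1 : p ≤ 1) (hps : 1 - p ^ 2 ≤ s ^ 2) (hs1 : s ≤ 1) (ht0 : 0 ≤ t) (hts : t ≤ s)
  (htp : (1 - p) * (1 + 2 * p) ≤ t * (1 + p)) (hst : p ^ 2 * (1 - p) ≤ s ^ 2 * (s - t))
include hp0 hp1 hps hs1 ht0 hts htp hst

omit hps hs1 ht0 hts hst in
/-- `1 - p ≤ t`. [folklore] -/
theorem one_sub_le_t : 1 - p ≤ t := by
  have hpos : (0 : ℝ) < 1 + p := by linarith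
  have h : (1 - p) * (1 + p) ≤ t * (1 + p) := by nlinarith
  exact le_of_mul_le_mul_right h hpos

omit hps hs1 ht0 hts hst in
/-- The ratio step for `P₀`: `(1-p)(1+(m+2)p) ≤ t (1+(m+1)p)`. [folklore] -/
theorem ratio_P0 (m : ℕ) : (1 - p) * (1 + (m + 2 : ℝ) * p) ≤ t * (1 + (m + 1 : ℝ) * p) := by
  have hm : (0 : ℝ) ≤ m := Nat.cast_nonneg m
  have h1 : (1 + (m + 2 : ℝ) * p) * (1 + p) ≤ (1 + 2 * p) * (1 + (m + 1 : ℝ) * p) := by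
    nlinarith [mul_nonneg hm (mul_nonneg hp0 hp0)]
  have h2 : (1 - p) * (1 + 2 * p) * (1 + (m + 1 : ℝ) * p) ≤ t * (1 + p) * (1 + (m + 1 : ℝ) * p) :=
    mul_le_mul_of_nonneg_right htp (by positivity)
  have h3 : (1 - p) * ((1 + (m + 2 : ℝ) * p) * (1 + p)) ≤ (1 - p) * ((1 + 2 * p) * (1 + (m + 1 : ℝ) * p)) :=
    mul_le_mul_of_nonneg_left h1 (by linarith)
  have hpos : (0 : ℝ) < 1 + p := by linarith
  have h4 : (1 - p) * (1 + (m + 2 : ℝ) * p) * (1 + p) ≤ t * (1 + (m + 1 : ℝ) * p) * (1 + p) := by nlinarith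
  exact le_of_mul_le_mul_right h4 hpos

omit hs1 hts hst in
/-- **Core 1**: `P₀(m+2) = (1-p)^{m+1} (1 + (m+1) p) ≤ s² t^m` (`P₀(r)` = at most one of `r` edges open). [folklore] -/
theorem core_P0 : ∀ m : ℕ, (1 - p) ^ (m + 1) * (1 + (m + 1 : ℝ) * p) ≤ s ^ 2 * t ^ m
  | 0 => by
    simp only [Nat.cast_zero, zero_add, pow_one, pow_zero, mul_one, one_mul]
    nlinarith
  | m + 1 => by
    have ih := core_P0 m
    have hq : 0 ≤ 1 - p := by linarith
    have hr := ratio_P0 hp0 hp1 htp m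
    have e1 : (1 - p) ^ (m + 1 + 1) * (1 + (↑(m + 1) + 1 : ℝ) * p) =
        (1 - p) ^ (m + 1) * ((1 - p) * (1 + (m + 2 : ℝ) * p)) := by push_cast; ring
    rw [e1]
    calc (1 - p) ^ (m + 1) * ((1 - p) * (1 + (m + 2 : ℝ) * p))
        ≤ (1 - p) ^ (m + 1) * (t * (1 + (m + 1 : ℝ) * p)) := mul_le_mul_of_nonneg_left hr (pow_nonneg hq _)
      _ = t * ((1 - p) ^ (m + 1) * (1 + (m + 1 : ℝ) * p)) := by ring
      _ ≤ t * (s ^ 2 * t ^ m) := mul_le_mul_of_nonneg_left ih ht0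
      _ = s ^ 2 * t ^ (m + 1) := by ring

omit hps hs1 ht0 hts hst in
/-- The ratio step for `Q`: `(1-p)(1+(m+1)p(1-p)) ≤ t (1 + m p (1-p))`. [folklore] -/
theorem ratio_Q (m : ℕ) : (1 - p) * (1 + (m + 1 : ℝ) * (p * (1 - p))) ≤ t * (1 + (m : ℝ) * (p * (1 - p))) := by
  have hm : (0 : ℝ) ≤ m := Nat.cast_nonneg m
  have hq : 0 ≤ p * (1 - p) := mul_nonneg hp0 (by linarith)
  -- `(1 + (m+1) q)(1+p) ≤ (1+2p)(1 + m q)` with `q = p(1-p)`: the difference is `p² + (m-1)pq + ... = p - q + (m - 1) p q`,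
  -- i.e. `p² (1 - (1-p)) ... `; directly: RHS - LHS = p² + m p q - q - p q + ... we let nlinarith find it
  have key : (1 + 2 * p) * (1 + (m : ℝ) * (p * (1 - p))) - (1 + (m + 1 : ℝ) * (p * (1 - p))) * (1 + p)
      = p ^ 3 + (m : ℝ) * (p * (1 - p)) * p := by ring
  have h1 : (1 + (m + 1 : ℝ) * (p * (1 - p))) * (1 + p) ≤ (1 + 2 * p) * (1 + (m : ℝ) * (p * (1 - p))) := by
    have : 0 ≤ p ^ 3 + (m : ℝ) * (p * (1 - p)) * p := by positivity
    linarith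
  have h2 : (1 - p) * (1 + 2 * p) * (1 + (m : ℝ) * (p * (1 - p))) ≤ t * (1 + p) * (1 + (m : ℝ) * (p * (1 - p))) :=
    mul_le_mul_of_nonneg_right htp (by positivity)
  have h3 : (1 - p) * ((1 + (m + 1 : ℝ) * (p * (1 - p))) * (1 + p)) ≤
      (1 - p) * ((1 + 2 * p) * (1 + (m : ℝ) * (p * (1 - p)))) := mul_le_mul_of_nonneg_left h1 (by linarith)
  have hpos : (0 : ℝ) < 1 + p := by linarith
  have h4 : (1 - p) * (1 + (m + 1 : ℝ) * (p * (1 - p))) * (1 + p) ≤ t * (1 + (m : ℝ) * (p * (1 - p))) * (1 + p) := by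
    nlinarith
  exact le_of_mul_le_mul_right h4 hpos

omit hps hs1 hts hst in
/-- **Core 2**: `Q(m+2) = (1-p)^m (1 + m p (1-p)) ≤ t^m` (`Q(r) = P₀(r) + p²(1-p)^{r-2}`: at most one edge open or the
first (good) pair open). [folklore] -/
theorem core_Q : ∀ m : ℕ, (1 - p) ^ m * (1 + (m : ℝ) * (p * (1 - p))) ≤ t ^ m
  | 0 => by simp
  | m + 1 => by
    have ih := core_Q m
    have hq : 0 ≤ 1 - p := by linarith
    have hr := ratio_Q hp0 hp1 htp m
    have e1 : (1 - p) ^ (m + 1) * (1 + (↑(m + 1) : ℝ) * (p * (1 - p))) =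
        (1 - p) ^ m * ((1 - p) * (1 + (m + 1 : ℝ) * (p * (1 - p)))) := by push_cast; ring
    rw [e1]
    calc (1 - p) ^ m * ((1 - p) * (1 + (m + 1 : ℝ) * (p * (1 - p))))
        ≤ (1 - p) ^ m * (t * (1 + (m : ℝ) * (p * (1 - p)))) := mul_le_mul_of_nonneg_left hr (pow_nonneg hq _)
      _ = t * ((1 - p) ^ m * (1 + (m : ℝ) * (p * (1 - p)))) := by ring
      _ ≤ t * t ^ m := mul_le_mul_of_nonneg_left ih ht0
      _ = t ^ (m + 1) := by ring

omit hp0 hp1 hps hs1 ht0 hts htp hst in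
/-- `siteProb (m+2) g` in terms of `P₀`: `(1-p)^{m+1}(1+(m+1)p) + g p² (1-p)^m`. [folklore] -/
theorem siteProb_add_two' (m g : ℕ) (p : ℝ) :
    siteProb (m + 2) g p = (1 - p) ^ (m + 1) * (1 + (m + 1 : ℝ) * p) + g * p ^ 2 * (1 - p) ^ m := by
  rw [siteProb_add_two]; ring

omit hp0 hp1 hps htp hst in
/-- Shifting units from `t` to `s` and dropping units increases `s^i t^j` (`0 ≤ t ≤ s ≤ 1`). [folklore] -/
theorem spow_tpow_le {i j a b : ℕ} (hb : b ≤ j) (hab : a + b ≤ i + j) : s ^ i * t ^ j ≤ s ^ a * t ^ b := by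
  have hs0 : 0 ≤ s := ht0.trans hts
  obtain ⟨c, rfl⟩ : ∃ c, j = b + c := ⟨j - b, by omega⟩
  calc s ^ i * t ^ (b + c) = s ^ i * t ^ c * t ^ b := by rw [pow_add]; ring
    _ ≤ s ^ i * s ^ c * t ^ b :=
        mul_le_mul_of_nonneg_right (mul_le_mul_of_nonneg_left (pow_le_pow_left₀ ht0 hts c) (pow_nonneg hs0 _))
          (pow_nonneg ht0 _)
    _ = s ^ (i + c) * t ^ b := by rw [pow_add]
    _ ≤ s ^ a * t ^ b := mul_le_mul_of_nonneg_right (pow_le_pow_of_le_one hs0 hs1 (by omega)) (pow_nonneg ht0 _)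

omit hps hs1 in
/-- The good-pair increment: `p² (1-p)^{i+j+1} ≤ s² (s - t) · s^i t^j`. [folklore] -/
theorem sq_mul_pow_le (i j : ℕ) : p ^ 2 * (1 - p) ^ (i + j + 1) ≤ s ^ 2 * (s - t) * (s ^ i * t ^ j) := by
  have hq : 0 ≤ 1 - p := by linarith
  have h1p_t : 1 - p ≤ t := one_sub_le_t hp0 hp1 htp
  have hB : (1 - p) ^ (i + j) ≤ s ^ i * t ^ j := by
    rw [pow_add]
    exact mul_le_mul (pow_le_pow_left₀ hq (h1p_t.trans hts) i) (pow_le_pow_left₀ hq h1p_t j) (pow_nonneg hq _)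
      (pow_nonneg (ht0.trans hts) _)
  have hst0 : 0 ≤ s ^ 2 * (s - t) := mul_nonneg (sq_nonneg _) (sub_nonneg.2 hts)
  calc p ^ 2 * (1 - p) ^ (i + j + 1) = (p ^ 2 * (1 - p)) * (1 - p) ^ (i + j) := by ring
    _ ≤ (s ^ 2 * (s - t)) * (s ^ i * t ^ j) := mul_le_mul hst hB (pow_nonneg hq _) hst0

omit hs1 in
/-- **Case "first pair not a good corner pair"**: `siteProb (m+2) g ≤ s^{g+2} t^{m-g}` for `g ≤ m`. [folklore] -/
theorem siteProb_le_core_bad {m g : ℕ} (hg : g ≤ m) : siteProb (m + 2) g p ≤ s ^ (g + 2) * t ^ (m - g) := by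
  induction g with
  | zero =>
    rw [siteProb_add_two', Nat.cast_zero, zero_mul, zero_mul, add_zero, Nat.sub_zero, zero_add]
    exact core_P0 hp0 hp1 hps ht0 htp m
  | succ g ih =>
    have ih' := ih (by omega)
    obtain ⟨k, hk⟩ : ∃ k, m - g = k + 1 := ⟨m - g - 1, by omega⟩
    have hk' : m - (g + 1) = k := by omega
    have hm : m = g + k + 1 := by omega
    rw [hk] at ih'
    rw [hk', siteProb_add_two', show (((g + 1 : ℕ) : ℝ)) = g + 1 by push_cast; ring]
    rw [siteProb_add_two'] at ih'
    have hinc := sq_mul_pow_le hp0 hp1 ht0 hts htp hst g k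
    rw [← hm] at hinc
    have e : s ^ (g + 1 + 2) * t ^ k = s ^ (g + 2) * t ^ (k + 1) + s ^ 2 * (s - t) * (s ^ g * t ^ k) := by ring
    rw [e]
    calc (1 - p) ^ (m + 1) * (1 + (m + 1 : ℝ) * p) + (g + 1) * p ^ 2 * (1 - p) ^ m
        = ((1 - p) ^ (m + 1) * (1 + (m + 1 : ℝ) * p) + g * p ^ 2 * (1 - p) ^ m) + p ^ 2 * (1 - p) ^ m := by ring
      _ ≤ s ^ (g + 2) * t ^ (k + 1) + s ^ 2 * (s - t) * (s ^ g * t ^ k) := add_le_add ih' hinc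

omit hps in
/-- **Case "first pair a good corner pair"**: `siteProb (m+2) g ≤ s^{g-1} t^{m+1-g}` for `1 ≤ g ≤ m + 1`. [folklore] -/
theorem siteProb_le_core_good {m g : ℕ} (hg1 : 1 ≤ g) (hg : g ≤ m + 1) :
    siteProb (m + 2) g p ≤ s ^ (g - 1) * t ^ (m + 1 - g) := by
  induction g with
  | zero => omega
  | succ g ih =>
    rcases Nat.eq_zero_or_pos g with rfl | hgpos
    · -- `g + 1 = 1`: `siteProb (m+2) 1 = (1-p)^m (1 + m p (1-p)) ≤ t^m`
      rw [siteProb_add_two', zero_add, Nat.sub_self, pow_zero, one_mul, show m + 1 - 1 = m by omega]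
      have e : (1 - p) ^ (m + 1) * (1 + (m + 1 : ℝ) * p) + ((1 : ℕ) : ℝ) * p ^ 2 * (1 - p) ^ m =
          (1 - p) ^ m * (1 + (m : ℝ) * (p * (1 - p))) := by push_cast; ring
      rw [e]
      exact core_Q hp0 hp1 ht0 htp m
    · have ih' := ih hgpos (by omega)
      obtain ⟨k, hk⟩ : ∃ k, m + 1 - g = k + 1 := ⟨m - g, by omega⟩
      have hk' : m + 1 - (g + 1) = k := by omega
      have hm : m = (g - 1) + k + 1 := by omega
      rw [hk] at ih'
      rw [hk', show g + 1 - 1 = (g - 1) + 1 by omega, siteProb_add_two',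
        show (((g + 1 : ℕ) : ℝ)) = g + 1 by push_cast; ring]
      rw [siteProb_add_two'] at ih'
      have hinc := sq_mul_pow_le hp0 hp1 ht0 hts htp hst (g - 1) k
      rw [← hm] at hinc
      have hs0 : 0 ≤ s := ht0.trans hts
      -- drop the factor `s² ≤ 1`
      have hinc' : p ^ 2 * (1 - p) ^ m ≤ (s - t) * (s ^ (g - 1) * t ^ k) := by
        refine hinc.trans ?_
        have h0 : 0 ≤ (s - t) * (s ^ (g - 1) * t ^ k) := by
          have := sub_nonneg.2 hts; positivity
        calc s ^ 2 * (s - t) * (s ^ (g - 1) * t ^ k) = s ^ 2 * ((s - t) * (s ^ (g - 1) * t ^ k)) := by ring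
          _ ≤ 1 * ((s - t) * (s ^ (g - 1) * t ^ k)) :=
              mul_le_mul_of_nonneg_right (pow_le_one₀ hs0 hs1) h0
          _ = _ := one_mul _
      have e : s ^ (g - 1 + 1) * t ^ k = s ^ (g - 1) * t ^ (k + 1) + (s - t) * (s ^ (g - 1) * t ^ k) := by ring
      rw [e]
      calc (1 - p) ^ (m + 1) * (1 + (m + 1 : ℝ) * p) + (g + 1) * p ^ 2 * (1 - p) ^ m
          = ((1 - p) ^ (m + 1) * (1 + (m + 1 : ℝ) * p) + g * p ^ 2 * (1 - p) ^ m) + p ^ 2 * (1 - p) ^ m := by ring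
        _ ≤ s ^ (g - 1) * t ^ (k + 1) + (s - t) * (s ^ (g - 1) * t ^ k) := add_le_add ih' hinc'

/-- **Per-site inequality, first pair not a good corner pair**: `a` units `s`, `b` units `t`, `g` good pairs with
`a + b ≤ r` and `g + b ≤ r - 2` (`r = m + 2`). [folklore] -/
theorem siteProb_le_pow2_of_first_bad {m g a b : ℕ} (hgb : g + b ≤ m) (hab : a + b ≤ m + 2) :
    siteProb (m + 2) g p ≤ s ^ a * t ^ b :=
  (siteProb_le_core_bad hp0 hp1 hps ht0 hts htp hst (by omega)).trans
    (spow_tpow_le hs1 ht0 hts (by omega) (by omega))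

omit hps in
/-- **Per-site inequality, first pair a good corner pair**: `a + b ≤ r - 2`, `1 ≤ g`, `g + b ≤ r - 1`. [folklore] -/
theorem siteProb_le_pow2_of_first_good {m g a b : ℕ} (hg1 : 1 ≤ g) (hgb : g + b ≤ m + 1) (hab : a + b ≤ m) :
    siteProb (m + 2) g p ≤ s ^ a * t ^ b :=
  (siteProb_le_core_good hp0 hp1 hs1 ht0 hts htp hst hg1 (by omega)).trans
    (spow_tpow_le hs1 ht0 hts (by omega) (by omega))

end Ineq2

end ChainBond

end Summit.CriticalPhenomena.PercolationContinuityZ3.Theorems.Pcint
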